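import Literature.Geometry.Riemannian.RicciDeTurckSystemStructure
import Literature.Geometry.Riemannian.RicciFlowExistenceReduction
import HarnessLib

/-!
# Short-time existence of the Ricci flow from quasilinear parabolic existence for vector-valued
# maps (topic `Geometry/Riemannian`)

Top layer of the reduction of the named fact
`Literature.Geometry.Riemannian.ricciFlow_shortTime_existence` (`RicciFlow.lean`; Hamilton 1982,
Thm. 4.2; DeTurck 1983; Topping 2006, Thm. 5.2.1). `RicciFlowExistenceReduction.lean` reduced the
fact, with proved glue, to (RDT) short-time existence of the Ricci–DeTurck flow on a closed
manifold (Topping 2006, §5.2, Step 1: "a solution exists by the theory of quasilinear parabolic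
equations"). This file PROVES (RDT) from the short-time existence theorem for quasilinear,
strictly parabolic, second-order systems for PLAIN vector-valued maps `u : M → W` on a closed
manifold with scalar principal part — the theorem of Taylor, *PDE III*, Ch. 15, §7 (local
existence for quasi-linear parabolic systems) / Mantegazza–Martinazzi 2012, Thm. 1.1 with the
remark on systems (p. 858) — taken as the hypothesis `hQL` (a hypothesis of the theorems below,
not a named fact), stated in charts: for an operator `𝒫` on maps `M → W` which in every extended
chart `φ_z` has the form `𝒫 u (φ_z⁻¹ y) = ∑ a(jet) i i' · ∂²_{bᵢ bᵢ'}(u ∘ φ_z⁻¹)(y) + f(jet)` with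
`C^∞` coefficients on an open jet domain over an open admissible set `𝒪 ⊆ M × W`, `a` symmetric
positive definite, every `C^∞` initial map with graph in `𝒪` is the initial value of a `C^∞`
solution of `∂ₜu = 𝒫 u` on `M × [0, ε]` with graph in `𝒪`.

* `ricciDeTurck_shortTime_existence_of_quasilinear` — (RDT) from `hQL`: the graph trick of
  `MetricAssembly.lean` (`𝒜 ∘ ℰ = sym`), the vector-valued system `𝒫 = 𝒟₀ + ℰ rdtForm 𝒜 - ℰ𝒜𝒟₀`
  and its identity `𝒜(𝒫 U) = rdtForm (𝒜U)` (`RicciDeTurckSystemOperators.lean`), and the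
  structure theorem with smooth, symmetric, positive definite coefficients
  (`RicciDeTurckSystemStructure.lean`) feed `hQL` with `u₀ = ℰ g₀`; the assembled metrics
  `g(t) = 𝒜 u(t)` form a Ricci–DeTurck flow with `g(0) = g₀` (`IsRicciDeTurckFlow`,
  `rdt_rhs_eq_of_isLeviCivita`).
* `ricciFlow_shortTime_existence_of_quasilinear` — the named fact from `hQL` alone
  (`ricciFlow_shortTime_existence_of_ricciDeTurck`).

Everything is proved; no named fact and no `sorry` is introduced. What remains for an outright
proof of the fact is the analytic theorem `hQL` itself (linear parabolic theory on closed
manifolds + quasilinear iteration).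

## References

* P. Topping, *Lectures on the Ricci flow*, LMS LNS 325 (2006), §5.2, Step 1 and Thm. 5.2.1.
  [Topping2006]
* R. S. Hamilton, Three-manifolds with positive Ricci curvature, J. Differential Geom. 17
  (1982), Thm. 4.2. [Hamilton1982]
* D. M. DeTurck, Deforming metrics in the direction of their Ricci tensors, J. Differential
  Geom. 18 (1983) 157–162. [DeTurck1983]
* M. E. Taylor, *Partial differential equations III. Nonlinear equations*, 2nd ed., Applied
  Math. Sciences 117, Springer 2011, Ch. 15, §7. [TaylorPDEIII2011]
* C. Mantegazza, L. Martinazzi, A note on quasilinear parabolic equations on manifolds,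
  Ann. Sc. Norm. Super. Pisa Cl. Sci. (5) 11 (2012) 857–874, Thm. 1.1 and p. 858.
  [MantegazzaMartinazzi2012]
-/

noncomputable section

set_option maxSynthPendingDepth 3

open Bundle Set Function Filter ContinuousLinearMap TopologicalSpace
open scoped Manifold ContDiff Topology

namespace Literature.Geometry.Riemannian

open Lorentzian Lorentzian.OpensChart Lorentzian.PseudoRiemannianMetric Literature.Geometry.Manifold
open Literature.Geometry.Riemannian.OpensChart

universe u v w

/-- **Short-time existence of the Ricci–DeTurck flow from quasilinear parabolic existence for
vector-valued maps.** ASSUME `hQL`, the chart-wise form of the short-time existence theorem for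
quasilinear strictly parabolic second-order systems with scalar principal part for maps
`u : M → W` on a closed manifold (Taylor, *PDE III*, Ch. 15, §7; Mantegazza–Martinazzi 2012,
Thm. 1.1 and p. 858): data — a basis `b` of the model space, an open admissible set
`𝒪 ⊆ M × W`, an operator `𝒫`, coefficient functions `a z : E × W × (E →L W) → ι → ι → ℝ`,
`f z : E × W × (E →L W) → W` for every point `z`, `C^∞` on the jet domain
`{(y, w, p) | y ∈ φ_z.target, (φ_z⁻¹ y, w) ∈ 𝒪}`, with `a` symmetric and positive definite there,
such that for every `C^∞` map `u` with graph in `𝒪`,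
`𝒫 u (φ_z⁻¹ y) = ∑ᵢᵢ' a z (jet) i i' • D²(u ∘ φ_z⁻¹)(y)(bᵢ, bᵢ') + f z (jet)` on the chart
targets; conclusion — every `C^∞` map `u₀` with graph in `𝒪` is the initial value of a map `u`,
`C^∞` on `M × [0, ε]` for some `ε > 0`, with graph in `𝒪` and `∂ₜu = 𝒫 u(t)` on `[0, ε]`
(one-sided at the endpoints). THEN hypothesis (RDT) of
`ricciFlow_shortTime_existence_of_ricciDeTurck` holds: on every closed manifold, every `C^∞`
Riemannian metric `g₀` is the initial value of a Ricci–DeTurck flow on `[0, ε]` relative to any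
Levi-Civita connection of `g₀` (Topping 2006, §5.2, Step 1). Proof: apply `hQL` to the
vector-valued Ricci–DeTurck system `𝒫 = ChartCover.P` of an arbitrary finite chart cover
(`P_chart`, `contDiffOn_aCoef`, `contDiffOn_fCoef`, `aCoef_symm`, `aCoef_pos`,
`isOpen_posSet`) with `u₀ = ℰ g₀`, and assemble: `g(t) = 𝒜 u(t)` is `C^∞` on `M × [0, ε]`
(`contMDiffOn_assemble_family`), `g(0) = 𝒜 ℰ g₀ = g₀` (`assemble_embed_of_symm`), and
`∂ₜ g = 𝒜(𝒫 u) = rdtForm (𝒜u) g₀ = -2 Ric + ℒ_W g` (`assembleAt_P`, `rdt_rhs_eq_of_isLeviCivita`).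
[cite: Topping2006, §5.2, Step 1] [cite: TaylorPDEIII2011, Ch. 15, §7]
[cite: MantegazzaMartinazzi2012, Thm. 1.1] -/
theorem ricciDeTurck_shortTime_existence_of_quasilinear
    (hQL : ∀ {E : Type u} [NormedAddCommGroup E] [NormedSpace ℝ E] [FiniteDimensional ℝ E]
      [CompleteSpace E] {H : Type v} [TopologicalSpace H] (I : ModelWithCorners ℝ E H)
      [I.Boundaryless] (M : Type w) [TopologicalSpace M] [T2Space M] [SecondCountableTopology M]
      [CompactSpace M] [ChartedSpace H M] [IsManifold I ∞ M]
      {W : Type u} [NormedAddCommGroup W] [NormedSpace ℝ W] [FiniteDimensional ℝ W]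
      {ι : Type} [Fintype ι] [DecidableEq ι] (b : Module.Basis ι ℝ E)
      (𝒪 : Set (M × W)) (_ : IsOpen 𝒪) (P : (M → W) → M → W)
      (a : M → E × W × (E →L[ℝ] W) → ι → ι → ℝ) (f : M → E × W × (E →L[ℝ] W) → W),
      (∀ z i i', ContDiffOn ℝ ∞ (fun j ↦ a z j i i')
        {j | j.1 ∈ (extChartAt I z).target ∧ ((extChartAt I z).symm j.1, j.2.1) ∈ 𝒪}) →
      (∀ z, ContDiffOn ℝ ∞ (f z)
        {j | j.1 ∈ (extChartAt I z).target ∧ ((extChartAt I z).symm j.1, j.2.1) ∈ 𝒪}) →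
      (∀ z (j : E × W × (E →L[ℝ] W)), j.1 ∈ (extChartAt I z).target →
        ((extChartAt I z).symm j.1, j.2.1) ∈ 𝒪 →
          (∀ i i', a z j i i' = a z j i' i) ∧
            ∀ ξ : ι → ℝ, ξ ≠ 0 → 0 < ∑ i, ∑ i', a z j i i' * ξ i * ξ i') →
      (∀ u : M → W, ContMDiff I 𝓘(ℝ, W) ∞ u → (∀ x, (x, u x) ∈ 𝒪) →
        ∀ z, ∀ y ∈ (extChartAt I z).target,
          P u ((extChartAt I z).symm y) =
            (∑ i, ∑ i', a z (y, u ((extChartAt I z).symm y), fderiv ℝ (u ∘ (extChartAt I z).symm) y)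
                i i' • fderiv ℝ (fderiv ℝ (u ∘ (extChartAt I z).symm)) y (b i) (b i')) +
              f z (y, u ((extChartAt I z).symm y), fderiv ℝ (u ∘ (extChartAt I z).symm) y)) →
      ∀ u₀ : M → W, ContMDiff I 𝓘(ℝ, W) ∞ u₀ → (∀ x, (x, u₀ x) ∈ 𝒪) →
        ∃ ε : ℝ, 0 < ε ∧ ∃ u : M → ℝ → W,
          ContMDiffOn (I.prod 𝓘(ℝ, ℝ)) 𝓘(ℝ, W) ∞ (fun p : M × ℝ ↦ u p.1 p.2) (univ ×ˢ Icc 0 ε) ∧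
          (∀ x, u x 0 = u₀ x) ∧ (∀ t ∈ Icc (0 : ℝ) ε, ∀ x, (x, u x t) ∈ 𝒪) ∧
          ∀ t ∈ Icc (0 : ℝ) ε, ∀ x,
            HasDerivWithinAt (u x) (P (fun x' ↦ u x' t) x) (Icc 0 ε) t) :
    ∀ {E : Type u} [NormedAddCommGroup E] [NormedSpace ℝ E] [FiniteDimensional ℝ E]
      [CompleteSpace E] {H : Type v} [TopologicalSpace H] (I : ModelWithCorners ℝ E H)
      [I.Boundaryless] (M : Type w) [TopologicalSpace M] [T2Space M] [SecondCountableTopology M]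
      [CompactSpace M] [ChartedSpace H M] [IsManifold I ∞ M]
      (g₀ : PseudoRiemannianMetric I ∞ E (TangentSpace I : M → Type _)), g₀.IsRiemannian →
      ∀ (bg : CovariantDerivative I E (TangentSpace I : M → Type _)), g₀.IsLeviCivita bg →
      ∃ ε : ℝ, 0 < ε ∧
        ∃ (g : ℝ → PseudoRiemannianMetric I ∞ E (TangentSpace I : M → Type _))
          (cov : ℝ → CovariantDerivative I E (TangentSpace I : M → Type _)),
          IsRicciDeTurckFlow g cov bg (Icc 0 ε) ∧ g 0 = g₀ := by
  intro E _ _ _ _ H _ I _ M _ _ _ _ _ _ g₀ hg₀ bg hbg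
  classical
  haveI := g₀.hasLeviCivita
  -- a finite chart cover, a basis, and the vector-valued Ricci–DeTurck system
  obtain ⟨N, ⟨𝒞⟩⟩ := ChartCover.exists I M
  set b := Module.finBasis ℝ E with hb
  -- the initial map `u₀ = ℰ g₀` is admissible
  set u₀ : M → Fin N → (E →L[ℝ] E →L[ℝ] ℝ) := 𝒞.embed g₀.val with hu₀def
  have hu₀s : ContMDiff I 𝓘(ℝ, Fin N → (E →L[ℝ] E →L[ℝ] ℝ)) ∞ u₀ := 𝒞.contMDiff_embed g₀
  have hAE : 𝒞.assemble u₀ = g₀.val := 𝒞.assemble_embed_of_symm g₀.symm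
  have hu₀𝒪 : ∀ x, (x, u₀ x) ∈ 𝒞.posSet := by
    intro x v hv
    change 0 < 𝒞.assemble u₀ x v v
    rw [hAE]
    exact hg₀ x v hv
  -- apply the quasilinear existence theorem
  obtain ⟨ε, hε, u, hus, hu0, hu𝒪, hder⟩ := hQL I M b 𝒞.posSet 𝒞.isOpen_posSet (𝒞.P b g₀)
    (fun z j i i' ↦ 𝒞.aCoef b z j i i') (fun z j ↦ 𝒞.fCoef b g₀ z j)
    (fun z i i' ↦ 𝒞.contDiffOn_aCoef b z i i') (fun z ↦ 𝒞.contDiffOn_fCoef b g₀ z)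
    (fun z j hj1 hj2 ↦ ⟨fun i i' ↦ 𝒞.aCoef_symm b z j i i',
      fun ξ hξ ↦ 𝒞.aCoef_pos b z (j := j) ⟨hj1, hj2⟩ hξ⟩)
    (fun U hU hU𝒪 z y hy ↦ 𝒞.P_chart b g₀ (U := U) ⟨hU, hU𝒪⟩ z hy) u₀ hu₀s hu₀𝒪
  -- the admissible vector-valued family, frozen outside `[0, ε]`
  set prj : ℝ → ℝ := fun t ↦ (projIcc (0 : ℝ) ε hε.le t : ℝ) with hπdef
  have hπmem : ∀ t, prj t ∈ Icc (0 : ℝ) ε := fun t ↦ (projIcc (0 : ℝ) ε hε.le t).2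
  have hπid : ∀ {t}, t ∈ Icc (0 : ℝ) ε → prj t = t := fun ht ↦ by
    simp only [hπdef, projIcc_of_mem hε.le ht]
  set Ut : ℝ → M → Fin N → (E →L[ℝ] E →L[ℝ] ℝ) := fun t x ↦ u x (prj t) with hUtdef
  have hUt_smooth : ∀ t, ContMDiff I 𝓘(ℝ, Fin N → (E →L[ℝ] E →L[ℝ] ℝ)) ∞ (Ut t) := by
    intro t
    have hι : ContMDiff I (I.prod 𝓘(ℝ, ℝ)) ∞ (fun x : M ↦ ((x, prj t) : M × ℝ)) :=
      contMDiff_id.prodMk contMDiff_const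
    have h := hus.comp_contMDiff hι fun x ↦ ⟨mem_univ _, hπmem t⟩
    exact h
  have hadm : ∀ t, 𝒞.Adm (Ut t) := fun t ↦ ⟨hUt_smooth t, fun x ↦ hu𝒪 (prj t) (hπmem t) x⟩
  -- the assembled metrics and their Levi-Civita connections
  set g : ℝ → PseudoRiemannianMetric I ∞ E (TangentSpace I : M → Type _) :=
    fun t ↦ 𝒞.metricOf (Ut t) (hadm t) with hgdef
  have hgval : ∀ t x, (g t).val x = 𝒞.assembleAt (u x (prj t)) x := fun t x ↦ rfl
  set cov : ℝ → CovariantDerivative I E (TangentSpace I : M → Type _) := fun t ↦ by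
    haveI := (g t).hasLeviCivita
    exact (g t).leviCivita with hcovdef
  refine ⟨ε, hε, g, cov, ⟨?_, ?_, ?_⟩, ?_⟩
  · -- joint smoothness on `M × [0, ε]`
    have hfam := 𝒞.contMDiffOn_assemble_family (U := fun p : M × ℝ ↦ u p.1 p.2) (S := Icc 0 ε) hus
    refine hfam.congr fun p hp ↦ ?_
    have hp' : (g p.2).val p.1 = 𝒞.assembleAt (u p.1 p.2) p.1 := by rw [hgval, hπid hp.2]
    rw [hp']
  · -- Levi-Civita witnesses
    intro t _
    haveI := (g t).hasLeviCivita
    exact isLeviCivita_leviCivita_holds (g := g t)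
  · -- the Ricci–DeTurck equation
    intro t ht x X Y
    haveI := (g t).hasLeviCivita
    -- `s ↦ (g s)(x)(X, Y)` is `L ∘ (u x)` on `[0, ε]` for the linear map `L w = 𝒜_x w (X, Y)`
    set L : (Fin N → (E →L[ℝ] E →L[ℝ] ℝ)) →L[ℝ] ℝ :=
      LinearMap.toContinuousLinearMap
        { toFun := fun w ↦ 𝒞.assembleAt w x X Y
          map_add' := fun w w' ↦ by rw [𝒞.assembleAt_add, _root_.add_apply, _root_.add_apply]
          map_smul' := fun c w ↦ by
            simp only [RingHom.id_apply, 𝒞.assembleAt_apply, Pi.smul_apply, map_smul,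
              _root_.smul_apply, smul_eq_mul, Finset.mul_sum]
            refine Finset.sum_congr rfl fun i _ ↦ by ring } with hL
    have hL_apply : ∀ w, L w = 𝒞.assembleAt w x X Y := fun w ↦ rfl
    have hderL : HasDerivWithinAt (fun s ↦ L (u x s)) (L (𝒞.P b g₀ (fun x' ↦ u x' t) x))
        (Icc 0 ε) t :=
      L.hasFDerivAt.comp_hasDerivWithinAt t (hder t ht x)
    have hfun : ∀ s ∈ Icc (0 : ℝ) ε, (g s).val x X Y = L (u x s) := fun s hs ↦ by
      rw [hL_apply, hgval, hπid hs]
    have hUt : (fun x' ↦ u x' t) = Ut t := by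
      funext x'
      simp only [hUtdef, hπid ht]
    rw [hUt, hL_apply, 𝒞.assembleAt_P b g₀ (hadm t) x] at hderL
    -- the target derivative is the Ricci–DeTurck right-hand side of `g t`
    have hW := mdifferentiableAt_deTurckField_univ (g t) g₀ x
    have hrhs := rdt_rhs_eq_of_isLeviCivita (g t) g₀ (cov := cov t) (bg := bg)
      (isLeviCivita_leviCivita_holds (g := g t)) hbg hW X Y
    rw [hrhs, ← rdtForm_apply]
    exact hderL.congr_of_mem hfun ht
  · -- initial value
    refine PseudoRiemannianMetric.ext (funext fun x ↦ ?_)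
    ext v v'
    change 𝒞.assembleAt (u x (prj 0)) x v v' = g₀.val x v v'
    have h0 : prj 0 = 0 := hπid (left_mem_Icc.2 hε.le)
    rw [h0, hu0 x]
    change 𝒞.assemble u₀ x v v' = g₀.val x v v'
    rw [hAE]

/-- **The named fact `ricciFlow_shortTime_existence` (Hamilton 1982, Thm. 4.2) from quasilinear
parabolic existence for vector-valued maps alone**: `ricciFlow_shortTime_existence_of_ricciDeTurck`
(Topping 2006, §5.2, Steps 1–2 and Thm. 5.2.1, with the flows of Lee 2012, Thm. 9.48) with (RDT)
discharged by `ricciDeTurck_shortTime_existence_of_quasilinear`. The remaining hypothesis `hQL`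
is the local existence theorem for quasilinear strictly parabolic systems for plain maps
`M → W` on a closed manifold (Taylor, *PDE III*, Ch. 15, §7; Mantegazza–Martinazzi 2012,
Thm. 1.1 and p. 858). [cite: Topping2006, §5.2, Step 1 and Thm. 5.2.1]
[cite: Hamilton1982, Thm. 4.2] [cite: TaylorPDEIII2011, Ch. 15, §7] -/
theorem ricciFlow_shortTime_existence_of_quasilinear
    (hQL : ∀ {E : Type u} [NormedAddCommGroup E] [NormedSpace ℝ E] [FiniteDimensional ℝ E]
      [CompleteSpace E] {H : Type v} [TopologicalSpace H] (I : ModelWithCorners ℝ E H)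
      [I.Boundaryless] (M : Type w) [TopologicalSpace M] [T2Space M] [SecondCountableTopology M]
      [CompactSpace M] [ChartedSpace H M] [IsManifold I ∞ M]
      {W : Type u} [NormedAddCommGroup W] [NormedSpace ℝ W] [FiniteDimensional ℝ W]
      {ι : Type} [Fintype ι] [DecidableEq ι] (b : Module.Basis ι ℝ E)
      (𝒪 : Set (M × W)) (_ : IsOpen 𝒪) (P : (M → W) → M → W)
      (a : M → E × W × (E →L[ℝ] W) → ι → ι → ℝ) (f : M → E × W × (E →L[ℝ] W) → W),
      (∀ z i i', ContDiffOn ℝ ∞ (fun j ↦ a z j i i')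
        {j | j.1 ∈ (extChartAt I z).target ∧ ((extChartAt I z).symm j.1, j.2.1) ∈ 𝒪}) →
      (∀ z, ContDiffOn ℝ ∞ (f z)
        {j | j.1 ∈ (extChartAt I z).target ∧ ((extChartAt I z).symm j.1, j.2.1) ∈ 𝒪}) →
      (∀ z (j : E × W × (E →L[ℝ] W)), j.1 ∈ (extChartAt I z).target →
        ((extChartAt I z).symm j.1, j.2.1) ∈ 𝒪 →
          (∀ i i', a z j i i' = a z j i' i) ∧
            ∀ ξ : ι → ℝ, ξ ≠ 0 → 0 < ∑ i, ∑ i', a z j i i' * ξ i * ξ i') →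
      (∀ u : M → W, ContMDiff I 𝓘(ℝ, W) ∞ u → (∀ x, (x, u x) ∈ 𝒪) →
        ∀ z, ∀ y ∈ (extChartAt I z).target,
          P u ((extChartAt I z).symm y) =
            (∑ i, ∑ i', a z (y, u ((extChartAt I z).symm y), fderiv ℝ (u ∘ (extChartAt I z).symm) y)
                i i' • fderiv ℝ (fderiv ℝ (u ∘ (extChartAt I z).symm)) y (b i) (b i')) +
              f z (y, u ((extChartAt I z).symm y), fderiv ℝ (u ∘ (extChartAt I z).symm) y)) →
      ∀ u₀ : M → W, ContMDiff I 𝓘(ℝ, W) ∞ u₀ → (∀ x, (x, u₀ x) ∈ 𝒪) →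
        ∃ ε : ℝ, 0 < ε ∧ ∃ u : M → ℝ → W,
          ContMDiffOn (I.prod 𝓘(ℝ, ℝ)) 𝓘(ℝ, W) ∞ (fun p : M × ℝ ↦ u p.1 p.2) (univ ×ˢ Icc 0 ε) ∧
          (∀ x, u x 0 = u₀ x) ∧ (∀ t ∈ Icc (0 : ℝ) ε, ∀ x, (x, u x t) ∈ 𝒪) ∧
          ∀ t ∈ Icc (0 : ℝ) ε, ∀ x,
            HasDerivWithinAt (u x) (P (fun x' ↦ u x' t) x) (Icc 0 ε) t) :
    ricciFlow_shortTime_existence.{u, v, w} :=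
  ricciFlow_shortTime_existence_of_ricciDeTurck
    (ricciDeTurck_shortTime_existence_of_quasilinear hQL)

end Literature.Geometry.Riemannian

end
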